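import Mathlib
import HarnessLib

/-!
# ValiantsHypothesis / LacunarySymmetroid — crux `MatrixDescartes` (stmt-ValiantsHypothesis-18050, V1),
# line `Cruxes/MatrixDescartes/Lines/osculation_law.lean` («osculation-law»), stub `stub_recursion`, general position (ROUTE′):
# ARC AVOIDANCE FROM A NON-VANISHING RESULTANT (conditions (a1)/(a2) of NOTE-p7g13-18050-GP-density-sizing.md §8–§9)

The crossing-tolerant peel `peelPrime` keeps ONE general-position hypothesis besides finiteness of the osculation set: the arc
`b = C·t^N` carries no osculation point (`∀ p ∈ osc(Φ), p 1 ≠ C * p 0 ^ N`).  This file turns it into a ZARISKI condition on the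
curve, so that it can be transported along a segment of pencils like every other membership condition of the dense family: restrict
`Φ` and its bordered log-Hessian `H(Φ)` to the arc — `g_C(t) := Φ(t, C t^N)`, `k_C(t) := H(Φ)(t, C t^N)`, two real polynomials in `t`
(`MvPolynomial.aeval ![X, C C * X ^ N]`) —; if `g_C ≠ 0` and the resultant `Res_t(g_C, k_C)` is nonzero, then `g_C` and `k_C` have no
common root (Mathlib `Polynomial.resultant_eq_zero_iff`), i.e. NO osculation point lies on the arc.

* `eval_aeval_arc` — `(aeval ![X, C·X^N] Ψ).eval t = Ψ(t, C t^N)`.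
* `not_isRoot_of_isCoprime` — coprime polynomials have no common root.
* **`arc_avoids_osc_of_resultant_ne_zero`** — the statement above, in the Peel files' set-builder currency.

Honest framing: a generic-position LEMMA toward the OPEN stub `stub_recursion` (its density residue); nothing of the summit is proved;
`VP ≠ VNP` is NOT proved.  No definitions, no named facts.
-/

-- `Summit.ValiantsHypothesis.ValiantsHypothesis.…` is the tree's mandated single-conjunct layout (Sub = Summit).
set_option linter.dupNamespace false

noncomputable section

namespace Summit.ValiantsHypothesis.ValiantsHypothesis.Theorems.LacunarySymmetroidMatrixDescartes

open Polynomial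

namespace OsculationGeneric

/-- **Restriction to the arc**: `(aeval ![X, C·X^N] Ψ)(t) = Ψ(t, C·t^N)`. [folklore] -/
theorem eval_aeval_arc (Ψ : MvPolynomial (Fin 2) ℝ) (C : ℝ) (N : ℕ) (t : ℝ) :
    (MvPolynomial.aeval (![Polynomial.X, Polynomial.C C * Polynomial.X ^ N] : Fin 2 → ℝ[X]) Ψ).eval t =
      MvPolynomial.eval ![t, C * t ^ N] Ψ := by
  induction Ψ using MvPolynomial.induction_on with
  | C a => rw [MvPolynomial.aeval_C, MvPolynomial.eval_C, Polynomial.algebraMap_eq, eval_C]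
  | add p q hp hq => rw [map_add, eval_add, map_add, hp, hq]
  | mul_X p i hp =>
    rw [map_mul, eval_mul, map_mul, hp, MvPolynomial.aeval_X, MvPolynomial.eval_X]
    fin_cases i
    · simp
    · simp [eval_mul, eval_pow, eval_C, eval_X]

/-- Coprime polynomials over a field have no common root. [folklore] -/
theorem not_isRoot_of_isCoprime {f g : ℝ[X]} (h : IsCoprime f g) {t : ℝ} (hf : f.IsRoot t) : ¬ g.IsRoot t := by
  intro hg
  obtain ⟨a, b, hab⟩ := h
  have h1 := congrArg (Polynomial.eval t) hab
  rw [eval_add, eval_mul, eval_mul, hf.eq_zero, hg.eq_zero, mul_zero, mul_zero, add_zero, eval_one] at h1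
  exact zero_ne_one h1

/-- **Arc avoidance from a non-vanishing resultant**: if `g_C = Φ(·, C·^N) ≠ 0` and `Res(g_C, k_C) ≠ 0` for `k_C = H(Φ)(·, C·^N)`,
then no osculation point of `Φ` lies on the arc `b = C·t^N`. [folklore] -/
theorem arc_avoids_osc_of_resultant_ne_zero (Φ : MvPolynomial (Fin 2) ℝ) (C : ℝ) (N : ℕ)
    (hg : MvPolynomial.aeval (![Polynomial.X, Polynomial.C C * Polynomial.X ^ N] : Fin 2 → ℝ[X]) Φ ≠ 0)
    (hres : Polynomial.resultant
        (MvPolynomial.aeval (![Polynomial.X, Polynomial.C C * Polynomial.X ^ N] : Fin 2 → ℝ[X]) Φ)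
        (MvPolynomial.aeval (![Polynomial.X, Polynomial.C C * Polynomial.X ^ N] : Fin 2 → ℝ[X])
          (MvPolynomial.X 0 * MvPolynomial.pderiv 0 (MvPolynomial.X 0 * MvPolynomial.pderiv 0 Φ)
            * (MvPolynomial.X 1 * MvPolynomial.pderiv 1 Φ) ^ 2
          - 2 * (MvPolynomial.X 0 * MvPolynomial.pderiv 0 (MvPolynomial.X 1 * MvPolynomial.pderiv 1 Φ))
            * (MvPolynomial.X 0 * MvPolynomial.pderiv 0 Φ) * (MvPolynomial.X 1 * MvPolynomial.pderiv 1 Φ)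
          + MvPolynomial.X 1 * MvPolynomial.pderiv 1 (MvPolynomial.X 1 * MvPolynomial.pderiv 1 Φ)
            * (MvPolynomial.X 0 * MvPolynomial.pderiv 0 Φ) ^ 2)) ≠ 0) :
    ∀ p ∈ {p : Fin 2 → ℝ | 0 < p 0 ∧ 0 < p 1 ∧ MvPolynomial.eval p Φ = 0 ∧
      MvPolynomial.eval p
        (MvPolynomial.X 0 * MvPolynomial.pderiv 0 (MvPolynomial.X 0 * MvPolynomial.pderiv 0 Φ)
            * (MvPolynomial.X 1 * MvPolynomial.pderiv 1 Φ) ^ 2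
          - 2 * (MvPolynomial.X 0 * MvPolynomial.pderiv 0 (MvPolynomial.X 1 * MvPolynomial.pderiv 1 Φ))
            * (MvPolynomial.X 0 * MvPolynomial.pderiv 0 Φ) * (MvPolynomial.X 1 * MvPolynomial.pderiv 1 Φ)
          + MvPolynomial.X 1 * MvPolynomial.pderiv 1 (MvPolynomial.X 1 * MvPolynomial.pderiv 1 Φ)
            * (MvPolynomial.X 0 * MvPolynomial.pderiv 0 Φ) ^ 2) = 0},
      p 1 ≠ C * p 0 ^ N := by
  intro p hp harc
  obtain ⟨-, -, hΦ, hH⟩ := hp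
  have hp01 : p = ![p 0, C * p 0 ^ N] := by
    ext i
    fin_cases i
    · rfl
    · exact harc
  -- both restrictions vanish at `t = p 0`
  have hgroot : (MvPolynomial.aeval (![Polynomial.X, Polynomial.C C * Polynomial.X ^ N] : Fin 2 → ℝ[X]) Φ).IsRoot (p 0) := by
    rw [IsRoot, eval_aeval_arc, ← hp01]; exact hΦ
  have hkroot : (MvPolynomial.aeval (![Polynomial.X, Polynomial.C C * Polynomial.X ^ N] : Fin 2 → ℝ[X])
      (MvPolynomial.X 0 * MvPolynomial.pderiv 0 (MvPolynomial.X 0 * MvPolynomial.pderiv 0 Φ)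
            * (MvPolynomial.X 1 * MvPolynomial.pderiv 1 Φ) ^ 2
          - 2 * (MvPolynomial.X 0 * MvPolynomial.pderiv 0 (MvPolynomial.X 1 * MvPolynomial.pderiv 1 Φ))
            * (MvPolynomial.X 0 * MvPolynomial.pderiv 0 Φ) * (MvPolynomial.X 1 * MvPolynomial.pderiv 1 Φ)
          + MvPolynomial.X 1 * MvPolynomial.pderiv 1 (MvPolynomial.X 1 * MvPolynomial.pderiv 1 Φ)
            * (MvPolynomial.X 0 * MvPolynomial.pderiv 0 Φ) ^ 2)).IsRoot (p 0) := by
    rw [IsRoot, eval_aeval_arc, ← hp01]; exact hH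
  -- hence they are not coprime, hence the resultant vanishes
  have hnc : ¬ IsCoprime (MvPolynomial.aeval (![Polynomial.X, Polynomial.C C * Polynomial.X ^ N] : Fin 2 → ℝ[X]) Φ)
      (MvPolynomial.aeval (![Polynomial.X, Polynomial.C C * Polynomial.X ^ N] : Fin 2 → ℝ[X])
        (MvPolynomial.X 0 * MvPolynomial.pderiv 0 (MvPolynomial.X 0 * MvPolynomial.pderiv 0 Φ)
            * (MvPolynomial.X 1 * MvPolynomial.pderiv 1 Φ) ^ 2
          - 2 * (MvPolynomial.X 0 * MvPolynomial.pderiv 0 (MvPolynomial.X 1 * MvPolynomial.pderiv 1 Φ))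
            * (MvPolynomial.X 0 * MvPolynomial.pderiv 0 Φ) * (MvPolynomial.X 1 * MvPolynomial.pderiv 1 Φ)
          + MvPolynomial.X 1 * MvPolynomial.pderiv 1 (MvPolynomial.X 1 * MvPolynomial.pderiv 1 Φ)
            * (MvPolynomial.X 0 * MvPolynomial.pderiv 0 Φ) ^ 2)) := fun h => not_isRoot_of_isCoprime h hgroot hkroot
  exact hres (Polynomial.resultant_eq_zero_iff.2 ⟨Or.inl hg, hnc⟩)

end OsculationGeneric

end Summit.ValiantsHypothesis.ValiantsHypothesis.Theorems.LacunarySymmetroidMatrixDescartes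

end
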